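import Summits.QuantumFields.BalabanUV.Beta.GAN24.OneStepConstraintAxialLetters
import Summits.QuantumFields.BalabanUV.Beta.GAN24.OneStepConstraintModelLetters
import Summits.QuantumFields.BalabanUV.Beta.GAN24.EffectiveFormDelK

/-!
# `BalabanUV.Beta.GAN24.OneStepConstraintAxialCoercivity` — binder row G-an2-4 ∕ (CONV-C), routes C-R6° («VALUES») × R7 («TWO CURRENCIES») × pv09's B6 torus line, PART 179:
# THE (2.153) INPUT TRANSPORTED TO THE LINEAGE's STACKED-CONSTRAINT SHAPE, CAST-FREE — with the next blocking factor written `Lb·1`, pv09's carrier `Tor (fine (Lb·1) M′)` IS the source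
# of `QB 1 Lb M′`, `ker(re QB 1 Lb M′) = ker(QvOp (Lb·1) M′)`, pv09's tree `IsTree` implies PART 178's `rem`-tree, and so for `H = re Δ_k` (`Δ_k = Beta.BlockEffectiveAction.DelK … (fine (Lb·1) M′)`,
# = the lineage's `Σ_k` through PART 176) PART 178's `coercive_reg_QB_axial` FIRES with γ₀ = (1∕12d²)(Lb·1)^{−d−1}: the regularised coercivity of the GAUGE-FIXED one-loop step, k-UNIFORM
# (census V200′ (γ))  (unit b2b-balaban-gan24-p3, gen 59; v1)

NOT IN PRINT; OUR PROOF ([folklore] bookkeeping BY NAME over pv09's `B6Constraint2153QvOp.lower2153_DelK_of_QvOp` ((2.153) — KERNEL theorem for the typed (1.65) operator), β's `Beta.BlockEffectiveAction`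
(`DelK_posSemidef`, `DelK_conjTranspose`), `B6Cov2156TorusDelK.isReal_DelK`, `B6LowerBound2153Torus.rep_toT`, NE2's `BalabanAveragedCoerciveTower.Atow_QBlev_eq_submatrix` (at `k = 1`:
`QB 1 Lb M′ = QvOp (Lb·1) M′ ∘ unitIdx`), b05's `B5RealFields`, PART 173 `OneStepConstraintModelLetters` (`dotProduct_reM_mulVec`, `form_reM_le_opNorm`), PART 178 `coercive_reg_QB_axial`.
[Balaban1984PropagatorsII] (2.121) p. 244, (2.152)–(2.153) p. 249 LOCATE the objects; nothing printed is a hypothesis.)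
HONEST FRAMING (cell contract, verbatim): «discharging `BetaPertH` makes Bałaban's UV stability UNCONDITIONAL — a real constructive-QFT result; it is NOT the continuum limit
and NOT the Clay problem.»  HONEST DEPENDENCY (verbatim): «continuum YM on T⁴ ⇐ BetaPertH ∧ nine spine estimates (0/9 proved); BetaPertH ⇐ (D1) ∧ (D4) ∧ CAP+tail; G-an2-4 gates
asym, D1 and NE2/3/4.»

WHY (census V200′ (γ), gen 59).  PART 178 turned «regularised coercivity of the gauge-fixed one-loop step» into ONE input: a kernel coercivity of the fine form on `ker(re QB 1 Lb M′) ∩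
{rem-tree}`.  pv09 proved exactly that — (2.153) — for `H = re Δ_k` in box coordinates with the constraint `QvOp Lb′ M′` on `Tor (fine Lb′ M′)`.  The lineage's level-1 carrier is
`Tor (fine (Lb·1) M′)` (`QB 1 Lb M′` averages FROM it), which is NOT syntactically `Tor (fine Lb M′)`; but pv09's blocking factor is free, so THIS FILE instantiates it at `Lb′ := Lb·1`
and no cast is needed anywhere.

WHAT THIS FILE PROVES (0 sorry, 0 `def`; `Lb ≥ 1`, coarse torus `M′`, `d ≥ 2` in §4, every level `n ≥ 1`, `a > 0`):
* §1 **`QB_one_mulVec_apply`** (`(QB 1 Lb M′·v) i = (QvOp (Lb·1) M′·v)(unitIdx i)`), **`reM_QB_one_mulVec_eq_zero_iff`** (`(re QB 1 Lb M′)·z = 0 ↔ QvOp (Lb·1) M′·z̃ = 0` for real `z`).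
* §2 the fine form's letters for `H = re Δ_k`: `reDelK_transpose` (symmetric), `dotProduct_reDelK_nonneg` (PSD), `dotProduct_reDelK_le_opNorm` (`≤ ‖Δ_k‖|z|²`), `sum_sq_eq_dotProduct`.
* §3 **`remTree_of_isTree`** — pv09's `IsTree (Lb·1) Y p` implies PART 178's tree predicate at `idxEquiv p` (`rem = coordinate − corner`).
* §4 **`ker_coercive_reDelK_axial`** — THE INPUT: for real `z` with `(re QB 1 Lb M′)z = 0` and `z = 0` on the `rem`-tree bonds (pointwise),
  `(1∕12d²)(Lb·1)^{−d−1}·|z|² ≤ ⟨z, (re Δ_k) z⟩`; **`coercive_reg_DelK_axial`** — PART 178's `coercive_reg_QB_axial` DISCHARGED for `H = re Δ_k`: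
  `QGQInverse.Coercive (re Δ_k + Q_axᵀ(a′•1)Q_ax) γ_K`, `Q_ax = fromRows (re QB 1 Lb M′) E_tree`, `γ_K⁻¹ = max (4∕γ₀) ((4‖Δ_k‖e₂∕γ₀ + 2e₂)∕a′)`, `γ₀ = gamma2153one d (Lb·1)`,
  `e₂ = 4(Lb·1)^{2d}(1 + (Lb·1)^{−d}) + 2` — uniformly in the level `n` and in the volume `M′`.
WHAT IT IS NOT: `‖Δ_k‖` is left symbolic (a k-uniform bound is PART 118 ∕ β's (1.67) upper half); the statement is on pv09's carrier `Tor (fine (Lb·1) M′) × Fin d` for `Δ_k` — the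
lineage's `Σ_k` version is one rewrite with PART 176 `effForm_eq_DelK_submatrix` (unit torus `M = fine (Lb·1) M′`); PART 105's pseudo-distance letters on the stacked index and the
PART 170 ∕ 172-type ENDs remain (census V200′ (α′)(δ)).  SUPPLIER work; NEVER «G-an2-4 closed»; NOT (CONV-C), NOT D1, NOT `BetaPertH`, NOT continuum, NOT Clay.
Records: `HOME/b2b-balaban-gan24-p3/gen59/README.md`.
-/

noncomputable section

open scoped BigOperators Matrix ComplexOrder Matrix.Norms.L2Operator
open Finset Matrix

namespace Summit.QuantumFields.BalabanUV.Beta.GAN24.OneStepConstraintAxialCoercivity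

open Literature.MathematicalPhysics.QuantumFieldTheory.Balaban1983to89
open Literature.MathematicalPhysics.QuantumFieldTheory.Balaban1983to89.B5Prop11Plancherel (Tor fine)
open Literature.MathematicalPhysics.QuantumFieldTheory.Balaban1983to89.B5Prop11Lower (nsq nsq_nonneg)
open Literature.MathematicalPhysics.QuantumFieldTheory.Balaban1983to89.B5RealFields (IsReal reM cplx reM_apply cplx_apply reM_transpose_of_isHermitian)
open Literature.MathematicalPhysics.QuantumFieldTheory.Balaban1983to89.B5Block118 (QvOp)
open Literature.MathematicalPhysics.QuantumFieldTheory.Balaban1983to89.B5Bounds167Lattice (ofRealCfg)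
open Literature.MathematicalPhysics.QuantumFieldTheory.Balaban1983to89.B5G183RateUnitTower (lev)
open Literature.MathematicalPhysics.QuantumFieldTheory.Balaban1983to89.Beta.BlockEffectiveAction (DelK DelK_posSemidef DelK_conjTranspose)
open Literature.MathematicalPhysics.QuantumFieldTheory.Balaban1983to89.B6Elimination (corner corner_apply)
open Literature.MathematicalPhysics.QuantumFieldTheory.Balaban1983to89.B6BondElimination (IsTree)
open Literature.MathematicalPhysics.QuantumFieldTheory.Balaban1983to89.B6Lemma24Torus (pbox mem_pbox coarseSites)
open Literature.MathematicalPhysics.QuantumFieldTheory.Balaban1983to89.B6LowerBound2153Torus (toT rep rep_toT)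
open Literature.MathematicalPhysics.QuantumFieldTheory.Balaban1983to89.B6Cov2156TorusDelK (idxEquiv idxEquiv_apply gamma2153one isReal_DelK)
open Literature.MathematicalPhysics.QuantumFieldTheory.Balaban1983to89.B6Constraint2153QvOp (lower2153_DelK_of_QvOp)
open Summit.QuantumFields.BalabanUV.T4Continuum.BalabanLineAverage (QB)
open Summit.QuantumFields.BalabanUV.T4Continuum.BalabanAveragedTowerModes (rem)
open Summit.QuantumFields.BalabanUV.T4Continuum.CovariantAveragingTower (Atow Atow_zero Atow_succ)
open Summit.QuantumFields.BalabanUV.T4Continuum.BalabanAveragedTowerUnit (idx QBlev)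
open Summit.QuantumFields.BalabanUV.T4Continuum.BalabanAveragedCoerciveTower (unitIdx Atow_QBlev_eq_submatrix)
open Summit.QuantumFields.BalabanUV.Beta.GAN24.OneStepConstraintModelLetters (dotProduct_reM_mulVec form_reM_le_opNorm)
open Summit.QuantumFields.BalabanUV.Beta.GAN24.OneStepConstraintAxialLetters (coercive_reg_QB_axial)

variable {d : ℕ} (Lb : ℕ) [NeZero Lb] (M' : Fin d → ℕ) [hM' : ∀ μ, NeZero (M' μ)]

/-! ## §1 `QB 1 Lb M′` IS `QvOp (Lb·1) M′` read through `unitIdx` -/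

section Averaging

/-- **`QB_one_mulVec_apply`**: `(QB 1 Lb M′ · v) i = (QvOp (Lb·1) M′ · v)(unitIdx i)` — NE2's `Atow_QBlev_eq_submatrix` at `k = 1` (`Atow QBlev 1 = QBlev 0 = QB (lev Lb 0) Lb M′`,
`lev Lb 1 = Lb·1`). [folklore] -/
theorem QB_one_mulVec_apply (v : Tor (fine (Lb * 1) M') × Fin d → ℂ) (i : idx Lb M' 0) :
    (QB 1 Lb M' *ᵥ v) i = (QvOp (Lb * 1) M' *ᵥ v) (unitIdx Lb M' i) := by
  have h : QB 1 Lb M' = Atow (QBlev Lb M') 1 := by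
    rw [Atow_succ, Atow_zero, Matrix.one_mul]; rfl
  rw [h, Atow_QBlev_eq_submatrix]
  rfl

/-- **`reM_QB_one_mulVec_eq_zero_iff`** — THE NEXT CONSTRAINT IN BOTH CURRENCIES: for a real field `z` on the level-1 lattice `Tor (fine (Lb·1) M′)`,
`(re QB 1 Lb M′)·z = 0 ↔ QvOp (Lb·1) M′ · z̃ = 0` (`z̃ = z` read in `ℂ`; `unitIdx` is a bijection, `QB` is real). [folklore] -/
theorem reM_QB_one_mulVec_eq_zero_iff (z : Tor (fine (Lb * 1) M') × Fin d → ℝ) :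
    reM (QB 1 Lb M') *ᵥ z = 0 ↔ QvOp (Lb * 1) M' *ᵥ ofRealCfg (fine (Lb * 1) M') z = 0 := by
  have hreal : IsReal (QB 1 Lb M') := FirstOrderModelRealLetters.isReal_QB 1 Lb M'
  have hc : ∀ i : idx Lb M' 0, (((reM (QB 1 Lb M') *ᵥ z) i : ℝ) : ℂ) = (QvOp (Lb * 1) M' *ᵥ ofRealCfg (fine (Lb * 1) M') z) (unitIdx Lb M' i) := by
    intro i
    rw [← QB_one_mulVec_apply]
    have h := congrFun (hreal.cplx_mulVec z) i
    rw [cplx_apply] at h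
    rw [h]
    rfl
  constructor
  · intro hz
    funext j
    obtain ⟨i, rfl⟩ := (unitIdx Lb M').surjective j
    rw [← hc i, hz]
    exact Complex.ofReal_zero
  · intro hz
    funext i
    have h := hc i
    rw [hz] at h
    have h' : (((reM (QB 1 Lb M') *ᵥ z) i : ℝ) : ℂ) = 0 := by rw [h]; rfl
    exact_mod_cast h'

end Averaging

/-! ## §2 The fine form `H = re Δ_k`: symmetric, PSD, bounded -/

section Form

variable (n : ℕ) [NeZero n] (hn : 1 ≤ n) (a : ℝ) (ha : 0 < a)

/-- `(re Δ_k)ᵀ = re Δ_k`. [folklore] -/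
theorem reDelK_transpose : (reM (DelK n hn (fine (Lb * 1) M') a ha))ᵀ = reM (DelK n hn (fine (Lb * 1) M') a ha) :=
  reM_transpose_of_isHermitian (DelK_posSemidef n hn (fine (Lb * 1) M') a ha).isHermitian

/-- `0 ≤ ⟨z, (re Δ_k)z⟩` (`Δ_k ⪰ 0`). [folklore] -/
theorem dotProduct_reDelK_nonneg (z : Tor (fine (Lb * 1) M') × Fin d → ℝ) : 0 ≤ z ⬝ᵥ (reM (DelK n hn (fine (Lb * 1) M') a ha) *ᵥ z) := by
  rw [dotProduct_reM_mulVec (isReal_DelK n hn (fine (Lb * 1) M') a ha)]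
  have h := (DelK_posSemidef n hn (fine (Lb * 1) M') a ha).dotProduct_mulVec_nonneg (cplx z)
  rw [Complex.le_def] at h
  simpa using h.1

/-- `⟨z, (re Δ_k)z⟩ ≤ ‖Δ_k‖·|z|²`. [folklore] -/
theorem dotProduct_reDelK_le_opNorm (z : Tor (fine (Lb * 1) M') × Fin d → ℝ) :
    z ⬝ᵥ (reM (DelK n hn (fine (Lb * 1) M') a ha) *ᵥ z) ≤ ‖DelK n hn (fine (Lb * 1) M') a ha‖ * (z ⬝ᵥ z) :=
  form_reM_le_opNorm (isReal_DelK n hn (fine (Lb * 1) M') a ha) z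

/-- `Σ_s z(s)² = z ⬝ᵥ z`. [folklore] -/
theorem sum_sq_eq_dotProduct (z : Tor (fine (Lb * 1) M') × Fin d → ℝ) : ∑ s, z s ^ 2 = z ⬝ᵥ z := by
  rw [dotProduct]; exact Finset.sum_congr rfl fun s _ => sq (z s)

end Form

/-! ## §3 pv09's tree implies the `rem`-tree -/

section TreeDictionary

/-- **`remTree_of_isTree`** — for a box variable `p` with pv09's `IsTree (Lb·1) Y p` («corner ∈ Y ∧ p_μ + 1 < corner_μ + Lb·1 ∧ ∀ i < μ, p_i = corner_i», `corner = (Lb·1)⌊p∕(Lb·1)⌋`) the torus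
bond `idxEquiv p` is a `rem`-tree bond of PART 178: `rem_ν = 0` for `ν < μ` and `rem_μ + 1 < Lb` (`rem = p mod Lb` since `0 ≤ p_i < M_i`). [folklore] -/
theorem remTree_of_isTree {Y : Finset (Fin d → ℤ)} (p : B4.Idx (pbox (fine (Lb * 1) M')) d) (hp : IsTree (Lb * 1) Y p) :
    (∀ ν, ν < (idxEquiv (fine (Lb * 1) M') p).2 → ((rem 1 Lb M' (idxEquiv (fine (Lb * 1) M') p).1 ν : ℕ)) = 0) ∧
      ((rem 1 Lb M' (idxEquiv (fine (Lb * 1) M') p).1 (idxEquiv (fine (Lb * 1) M') p).2 : ℕ)) + 1 < Lb := by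
  have hLb : 0 < Lb := Nat.pos_of_ne_zero (NeZero.ne Lb)
  -- the coordinates of the torus point are the box coordinates
  have hval : ∀ ν, (((toT (fine (Lb * 1) M') (p.1 : Fin d → ℤ) ν).val : ℤ)) = (p.1 : Fin d → ℤ) ν :=
    fun ν => congrFun (rep_toT (fine (Lb * 1) M') p.1.2) ν
  have hrem : ∀ ν, (((rem 1 Lb M' (toT (fine (Lb * 1) M') (p.1 : Fin d → ℤ)) ν : ℕ)) : ℤ) = (p.1 : Fin d → ℤ) ν % (Lb : ℤ) := by
    intro ν
    rw [← hval ν]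
    simp only [rem, Fin.val_mk, Int.natCast_mod]
  obtain ⟨-, hμ, hlt⟩ := hp
  rw [idxEquiv_apply]
  dsimp only
  refine ⟨fun ν hν => ?_, ?_⟩
  · have h := hlt ν hν
    rw [corner_apply] at h
    simp only [mul_one] at h
    have e : (p.1 : Fin d → ℤ) ν % (Lb : ℤ) = 0 := by
      have hd := Int.mul_ediv_add_emod ((p.1 : Fin d → ℤ) ν) (Lb : ℤ)
      linarith
    have h2 := hrem ν
    rw [e] at h2
    exact_mod_cast h2
  · rw [corner_apply] at hμ
    simp only [mul_one] at hμ
    have hd := Int.mul_ediv_add_emod ((p.1 : Fin d → ℤ) p.2) (Lb : ℤ)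
    have h2 := hrem p.2
    have h3 : (p.1 : Fin d → ℤ) p.2 % (Lb : ℤ) + 1 < Lb := by linarith
    rw [← h2] at h3
    exact_mod_cast h3

end TreeDictionary

/-! ## §4 (2.153) in PART 178's shape; the regularised coercivity of the gauge-fixed one-loop step -/

section Coercivity

variable (n : ℕ) [NeZero n] (hn : 1 ≤ n) (a : ℝ) (ha : 0 < a)

/-- **`ker_coercive_reDelK_axial` — THE (2.153) INPUT IN THE LINEAGE's SHAPE**: for `d ≥ 2`, every real field `z` on the level-1 lattice `Tor (fine (Lb·1) M′)` with `(re QB 1 Lb M′)z = 0`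
(Bałaban's next averaging) and `z = 0` on the `rem`-tree bonds (axial gauge) satisfies `(1∕12d²)(Lb·1)^{−d−1}·|z|² ≤ ⟨z, (re Δ_k)z⟩` — pv09's `lower2153_DelK_of_QvOp` at blocking factor
`Lb·1`, through §1 and §3; uniformly in `n` and `M′`. [cite: Balaban1984PropagatorsII, (2.153) p.249] [folklore] -/
theorem ker_coercive_reDelK_axial (hd : 2 ≤ d) (z : Tor (fine (Lb * 1) M') × Fin d → ℝ) (hQ : reM (QB 1 Lb M') *ᵥ z = 0)
    (hT : ∀ t : {x : Tor (fine (Lb * 1) M') × Fin d // (∀ ν, ν < x.2 → ((rem 1 Lb M' x.1 ν : ℕ)) = 0) ∧ ((rem 1 Lb M' x.1 x.2 : ℕ)) + 1 < Lb}, z t.1 = 0) :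
    gamma2153one d (Lb * 1) * (z ⬝ᵥ z) ≤ z ⬝ᵥ (reM (DelK n hn (fine (Lb * 1) M') a ha) *ᵥ z) := by
  have hQ' : QvOp (Lb * 1) M' *ᵥ ofRealCfg (fine (Lb * 1) M') z = 0 := (reM_QB_one_mulVec_eq_zero_iff Lb M' z).mp hQ
  have hT' : ∀ p : B4.Idx (pbox (fine (Lb * 1) M')) d,
      IsTree (Lb * 1) (coarseSites (Lb * 1) (fine (Lb * 1) M')) p → z (idxEquiv (fine (Lb * 1) M') p) = 0 :=
    fun p hp => hT ⟨idxEquiv (fine (Lb * 1) M') p, remTree_of_isTree Lb M' p hp⟩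
  haveI : NeZero (Lb * 1) := ⟨by rw [Nat.mul_one]; exact NeZero.ne Lb⟩
  have h := lower2153_DelK_of_QvOp (Lb * 1) M' hd n hn a ha z hQ' hT'
  rw [sum_sq_eq_dotProduct] at h
  rw [dotProduct_reM_mulVec (isReal_DelK n hn (fine (Lb * 1) M') a ha)]
  exact h

/-- **`coercive_reg_DelK_axial` — THE REGULARISED COERCIVITY OF THE GAUGE-FIXED ONE-LOOP STEP, DISCHARGED**: for `d ≥ 2` and every `a′ > 0`,
`QGQInverse.Coercive (re Δ_k + Q_axᵀ(a′•1)Q_ax) (max (4∕γ₀) ((4‖Δ_k‖e₂∕γ₀ + 2e₂)∕a′))⁻¹` with `Q_ax = fromRows (re QB 1 Lb M′) E_tree`, `γ₀ = gamma2153one d (Lb·1) = (1∕12d²)(Lb·1)^{−d−1}`,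
`e₂ = 4(Lb·1)^{2d}(1 + (Lb·1)^{−d}) + 2` — PART 178's `coercive_reg_QB_axial` with its ONE model input supplied by pv09's (2.153); `Δ_k = DelK n hn (fine (Lb·1) M′) a ha` at EVERY level
`n`, every volume `M′` (the lineage's `Σ_k` through PART 176). [folklore] -/
theorem coercive_reg_DelK_axial (hd : 2 ≤ d) {a' : ℝ} (ha' : 0 < a') :
    QGQInverse.Coercive
      (reM (DelK n hn (fine (Lb * 1) M') a ha)
        + (Matrix.fromRows (reM (QB 1 Lb M'))
              (fun (t : {x : Tor (fine (Lb * 1) M') × Fin d // (∀ ν, ν < x.2 → ((rem 1 Lb M' x.1 ν : ℕ)) = 0) ∧ ((rem 1 Lb M' x.1 x.2 : ℕ)) + 1 < Lb})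
                (x : Tor (fine (Lb * 1) M') × Fin d) =>
                if x = (Function.Embedding.subtype _ t) then (1 : ℝ) else 0))ᵀ
            * (a' • (1 : Matrix ((Tor (fine 1 M') × Fin d) ⊕ {x : Tor (fine (Lb * 1) M') × Fin d // (∀ ν, ν < x.2 → ((rem 1 Lb M' x.1 ν : ℕ)) = 0) ∧ ((rem 1 Lb M' x.1 x.2 : ℕ)) + 1 < Lb})
                               ((Tor (fine 1 M') × Fin d) ⊕ {x : Tor (fine (Lb * 1) M') × Fin d // (∀ ν, ν < x.2 → ((rem 1 Lb M' x.1 ν : ℕ)) = 0) ∧ ((rem 1 Lb M' x.1 x.2 : ℕ)) + 1 < Lb}) ℝ))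
            * Matrix.fromRows (reM (QB 1 Lb M'))
              (fun (t : {x : Tor (fine (Lb * 1) M') × Fin d // (∀ ν, ν < x.2 → ((rem 1 Lb M' x.1 ν : ℕ)) = 0) ∧ ((rem 1 Lb M' x.1 x.2 : ℕ)) + 1 < Lb})
                (x : Tor (fine (Lb * 1) M') × Fin d) =>
                if x = (Function.Embedding.subtype _ t) then (1 : ℝ) else 0))
      (max (4 / gamma2153one d (Lb * 1))
        ((4 * ‖DelK n hn (fine (Lb * 1) M') a ha‖ * (4 * ((Lb : ℝ) ^ d) ^ 2 * (1 + ((Lb : ℝ) ^ d)⁻¹) + 2 * 1) / gamma2153one d (Lb * 1)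
          + 2 * (4 * ((Lb : ℝ) ^ d) ^ 2 * (1 + ((Lb : ℝ) ^ d)⁻¹) + 2 * 1)) / a'))⁻¹ :=
  coercive_reg_QB_axial 1 Lb M' (reDelK_transpose Lb M' n hn a ha) (dotProduct_reDelK_nonneg Lb M' n hn a ha) (norm_nonneg _)
    (dotProduct_reDelK_le_opNorm Lb M' n hn a ha)
    (B6Cov2156TorusDelK.gamma2153one_pos (le_trans (by norm_num) hd) (Nat.one_le_iff_ne_zero.2 (NeZero.ne (Lb * 1))))
    (fun z hQ hE => ker_coercive_reDelK_axial Lb M' n hn a ha hd z hQ (fun t => by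
      have h := congrFun hE t
      rw [StackedConstraintLetters.proj_mulVec, Pi.zero_apply] at h
      exact h)) ha'

end Coercivity

end Summit.QuantumFields.BalabanUV.Beta.GAN24.OneStepConstraintAxialCoercivity

end
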